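import Literature.NumberTheory.GaloisRepresentations.LubinTateColemanUnitsImageTraceTwo
import HarnessLib

/-!
# The `ℤ/d`-trace of the two-variable Coleman image IS the Coleman image of the NORM to the `ℤ_p`-subtower:
# `Σ_j Col_E(β)(j) = Col_{E'}(N_{E/E'} β)` — de Shalit I §3.8 (16)–(17) (`i` commutes with the norm / restriction) for `E'_m = E_m^{ℤ/d}`

De Shalit, *Iwasawa theory of elliptic curves with complex multiplication* (1987), Ch. I §3.1, §3.5, §3.8 (16)–(17), Ch. III §1.2 Lemma (ii), §1.3.
`LubinTateColemanUnitsImageTraceTwo` introduced the index trace `Σ : (ZMod d → M₁) → M₁` on which the brick-(c) chain runs for an unramified tower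
`E` of arbitrary degree `[E_m : F] = d·p^m`.  THIS file identifies `Σ ∘ Col_E` with the Coleman map of the `ℤ_p`-SUBTOWER: for a second tower
`E'_m ≤ E_m` of degree `p^m` (the fixed fields of the prime-to-`p` part `ℤ/d`), the trace-coherent generators `θ'_m = Tr_{E_m/E'_m} θ_m` and the
norm family `β'_m = N_{E_m/E'_m} β_m`, **`Σ_j Col_E(β)(j) = Col_{E'}(β')`** (the `d = 1` transform of `LubinTateColemanUnitsImageEquivTwo` along `E'`).
So the trace chain's `N_Σ`, `Col_Σ(C)` are the image of the Coleman map of the `ℤ_p`-tower on the NORMS — de Shalit's commutative square (16)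
(`i ∘ N = res ∘ i`) for the restriction `Λ(ℤ/d × ℤ_p) → Λ(ℤ_p)`.  Everything PROVED (0 sorry, no definitions, no named facts):

* §1 `val_chineseRemainder_symm_mod` (CRT bookkeeping: `χ_m⁻¹(j, i) ≡ i (mod p^m)`),
  ★★ `sum_amiceSum_eq_amiceSum_trace` — `Σ_j Φ_m(y)(j) = Φ'_m(Tr y)` EXACTLY: the fibre of `Gal(E_m/F) ↠ Gal(E'_m/F)` over `φ'^i` is
  `{φ^{χ⁻¹(j,i)} : j ∈ ℤ/d}` (`IsIntegralNormalGen.repr_unitBallTrace`); `IsAmiceLevel.indexTrace`;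
* §2 `isIntegralNormalGen_subtower`, `coherent_subtower`, `baseNormCoherent_subtower` (the sub-tower data `θ' = Tr θ`, `β' = N β` are again
  trace- and norm-coherent); ★ `isTransformProd_sum_colemanImage` (the trace of `Col_E β` satisfies the `d = 1` transform congruences of `β'`,
  `unitBallTrace_coeff_relUnitCoordTwo`); ★★★ **`indexTraceₗ_colemanImage_eq_colemanImage_subtower`** — `Σ (Col_E β) = Col_{E'}(N β)(0)`.

Cell `bsd-print-cf2`, width seat `bsd-line-cf2c-w7` g17 (finding F7 of BRICK-C-TRACE-g17 made a theorem).

## References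
* E. de Shalit, *Iwasawa theory of elliptic curves with complex multiplication* (1987), Ch. I §3.1, §3.5, §3.8 (16)–(17); Ch. III §1.2–1.3. [deShalit1987]
* J.-P. Serre, *Local Fields* (1979), Ch. I §4 Prop. 10, Ch. I §7. [SerreLocalFields1979]
-/

noncomputable section

open scoped PowerSeries.WithPiTopology

namespace Literature.NumberTheory.GaloisRepresentations

section UnitsImageTraceNormTwo

open GaloisRepresentations.IsNonarchimedeanLocalField LubinTate ValuativeRel Field Finset

variable {F : Type} [Field F] [ValuativeRel F] [TopologicalSpace F] [IsNonarchimedeanLocalField F]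

attribute [local instance] ltNormUniformSpace ltNormIsUniformAddGroup rk1 nF nE fintypeResidueField

variable {p : ℕ} [hp : Fact p.Prime] {d : ℕ} [NeZero d] (hd : d.Coprime p)
variable {π : 𝒪[F]} (hπ : (valuation F).IsUniformizer (π : F))
variable (E E' : ℕ → IntermediateField F (AlgebraicClosure F)) [∀ m, FiniteDimensional F (E m)] [∀ m, Normal F (E m)] [∀ m, IsGalois F (E m)]
  [∀ m, FiniteDimensional F (E' m)] [∀ m, Normal F (E' m)] [∀ m, IsGalois F (E' m)]
  (hmono : Monotone E) (hmono' : Monotone E') (h : ∀ m, E' m ≤ E m)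
  (hE : ∀ m, E m ≤ maxUnramified F) (hE' : ∀ m, E' m ≤ maxUnramified F)
  (hdeg : ∀ m, Module.finrank F (E m) = d * p ^ m) (hdeg' : ∀ m, Module.finrank F (E' m) = 1 * p ^ m)
  {σ₀ : absoluteGaloisGroup F} (hσ₀ : IsAbsArithFrob σ₀) (hq : residueFieldCard F = 2)
variable (u : (LTCoeff F)ˣ) (hu : LTCoeff.of F π = residueFieldCard F * u) (γ : 𝒪[F]ˣ)

/-! ### §1. CRT bookkeeping and the fibre identity `Σ_j Φ_m(y)(j) = Φ'_m(Tr y)` -/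

omit hp in
/-- **`χ⁻¹(j, i).val ≡ i.val (mod n)`** for `χ : ℤ/mn ≅ ℤ/m × ℤ/n`, `n ≠ 0`. [cite: deShalit1987, Ch. I §3.1] -/
theorem val_chineseRemainder_symm_mod {m n : ℕ} [NeZero m] [NeZero n] (hmn : m.Coprime n) (j : ZMod m) (i : ZMod n) :
    ((ZMod.chineseRemainder hmn).symm (j, i)).val % n = i.val := by
  haveI : NeZero (m * n) := ⟨mul_ne_zero (NeZero.ne m) (NeZero.ne n)⟩
  -- the second CRT component of `x` is `x mod n` (the tree's `Zolotarev.chineseRemainder_apply_snd`, inlined)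
  have h2 : (ZMod.chineseRemainder hmn ((ZMod.chineseRemainder hmn).symm (j, i))).2 =
      (ZMod.cast ((ZMod.chineseRemainder hmn).symm (j, i)) : ZMod n) := by
    change (ZMod.cast ((ZMod.chineseRemainder hmn).symm (j, i)) : ZMod m × ZMod n).2 = _
    exact Prod.snd_zmod_cast _
  rw [RingEquiv.apply_symm_apply, ZMod.cast_eq_val] at h2
  rw [← ZMod.val_natCast (n := n), ← h2]

omit hp [NeZero d] in
include hE' hdeg' hσ₀ in
/-- `φ'^N = φ'^{N mod p^m}` on `E'_m` (`φ'` has order `[E'_m : F] = p^m`). [cite: SerreLocalFields1979, Ch. I §4 Prop. 10] -/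
theorem frobPow_subtower_eq_pow_mod (m N : ℕ) :
    ((absoluteGaloisGroup.toAlgEquiv F σ₀).restrictNormal (E' m)) ^ N =
      ((absoluteGaloisGroup.toAlgEquiv F σ₀).restrictNormal (E' m)) ^ (N % p ^ m) := by
  have ho : orderOf ((absoluteGaloisGroup.toAlgEquiv F σ₀).restrictNormal (E' m)) = p ^ m := by
    rw [orderOf_restrictNormal_eq_finrank (E' m) (hE' m) hσ₀, hdeg' m, one_mul]
  rw [← ho, pow_mod_orderOf]

include hE hE' hdeg hdeg' hσ₀ in
/-- ★★ **`Σ_j Φ_m(y)(j) = Φ'_m(Tr_{E_m/E'_m} y)`** — the sum over `ℤ/d` of the level-`m` Amice–CRT polynomials of `y ∈ 𝒪_{E_m}` (generator `θ`,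
`[E_m:F] = d·p^m`) is the level-`m` Amice polynomial (`d = 1`) of `Tr y ∈ 𝒪_{E'_m}` for the generator `Tr θ`: the coordinates of `Tr y` are the
fibre sums (`IsIntegralNormalGen.repr_unitBallTrace`), and the fibre of `Gal(E_m/F) ↠ Gal(E'_m/F)` over `φ'^i` is `{φ^{χ⁻¹(j,i)} : j ∈ ℤ/d}`.
[cite: deShalit1987, Ch. I §3.1, §3.8 (16)] -/
theorem sum_amiceSum_eq_amiceSum_trace (m : ℕ) {θ : unitBall (E m)} (hθ : IsIntegralNormalGen (E m) θ) (y : unitBall (E m)) (j' : ZMod 1) :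
    ∑ j : ZMod d, amiceSum p d hd σ₀ (E := E) hθ y j =
      amiceSum p 1 (Nat.coprime_one_left p) σ₀ (E := E') (hθ.unitBallTrace (h m)) (unitBallTrace (h m) y) j' := by
  classical
  haveI : NeZero (p ^ m) := ⟨pow_ne_zero m hp.out.ne_zero⟩
  set φ := (absoluteGaloisGroup.toAlgEquiv F σ₀).restrictNormal (E m) with hφ
  set φ' := (absoluteGaloisGroup.toAlgEquiv F σ₀).restrictNormal (E' m) with hφ'
  -- restriction of powers of `φ`
  have hres : ∀ N : ℕ, towerRestrict (h m) (φ ^ N) = φ' ^ (N % p ^ m) := fun N => by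
    rw [map_pow, hφ, towerRestrict_restrictNormal, ← hφ']
    exact frobPow_subtower_eq_pow_mod E' hE' hdeg' hσ₀ m N
  unfold amiceSum
  rw [Finset.sum_comm]
  refine Finset.sum_congr rfl fun i _ => ?_
  have hn' : φ' ^ ((ZMod.chineseRemainder ((Nat.coprime_one_left p).pow_right m)).symm (j', i)).val = φ' ^ i.val := by
    rw [frobPow_subtower_eq_pow_mod E' hE' hdeg' hσ₀ m, val_chineseRemainder_symm_mod]
  have hbij := frobPow_bijective_cyclic p d E hE hdeg hσ₀ m
  have key : ∑ j : ZMod d, hθ.basis.repr y (φ ^ ((ZMod.chineseRemainder (hd.pow_right m)).symm (j, i)).val) =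
      (hθ.unitBallTrace (h m)).basis.repr (unitBallTrace (h m) y)
        (((absoluteGaloisGroup.toAlgEquiv F σ₀).restrictNormal (E' m)) ^
          ((ZMod.chineseRemainder ((Nat.coprime_one_left p).pow_right m)).symm (j', i)).val) := by
    rw [IsIntegralNormalGen.repr_unitBallTrace (h m) hθ, ← hφ', hn']
    refine Finset.sum_bij (fun j _ => φ ^ ((ZMod.chineseRemainder (hd.pow_right m)).symm (j, i)).val) (fun j _ => ?_) (fun j₁ _ j₂ _ hj => ?_)
      (fun σ hσ => ?_) (fun j _ => rfl)
    · rw [mem_filter]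
      exact ⟨mem_univ _, by rw [hres, val_chineseRemainder_symm_mod]⟩
    · have hinj := hbij.1 (a₁ := (ZMod.chineseRemainder (hd.pow_right m)).symm (j₁, i))
        (a₂ := (ZMod.chineseRemainder (hd.pow_right m)).symm (j₂, i)) hj
      have := congrArg (fun z => ((ZMod.chineseRemainder (hd.pow_right m)) z).1) hinj
      simpa using this
    · rw [mem_filter] at hσ
      obtain ⟨M, rfl⟩ := hbij.2 σ
      refine ⟨((ZMod.chineseRemainder (hd.pow_right m)) M).1, mem_univ _, ?_⟩
      -- the second CRT component of `M` is `i`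
      have h2 : ((ZMod.chineseRemainder (hd.pow_right m)) M).2 = i := by
        have hr := hσ.2
        simp only at hr
        rw [hres] at hr
        -- `φ'^{M.val % p^m} = φ'^{i.val}` with both exponents `< p^m = orderOf φ'`
        have ho : orderOf φ' = p ^ m := by
          rw [hφ', orderOf_restrictNormal_eq_finrank (E' m) (hE' m) hσ₀, hdeg' m, one_mul]
        have hlt₁ : M.val % p ^ m < orderOf φ' := by rw [ho]; exact Nat.mod_lt _ (pow_pos hp.out.pos m)
        have hlt₂ : i.val < orderOf φ' := by rw [ho]; exact ZMod.val_lt i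
        have hval : M.val % p ^ m = i.val := pow_injOn_Iio_orderOf hlt₁ hlt₂ hr
        have hc : ((ZMod.chineseRemainder (hd.pow_right m)) M).2 = (ZMod.cast M : ZMod (p ^ m)) := by
          change (ZMod.cast M : ZMod d × ZMod (p ^ m)).2 = _
          exact Prod.snd_zmod_cast _
        rw [hc, ZMod.cast_eq_val]
        apply ZMod.val_injective
        rw [ZMod.val_natCast, hval]
      have hM : (ZMod.chineseRemainder (hd.pow_right m)).symm (((ZMod.chineseRemainder (hd.pow_right m)) M).1, i) = M := by
        rw [RingEquiv.symm_apply_eq, ← h2]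
      simp only [hM, hφ]
  rw [← Finset.sum_mul, ← map_sum, key]

include hE hE' hdeg hdeg' hσ₀ in
/-- ★ **Amice pairs pass to the trace**: if `(x, y)` is a level-`m` Amice pair for `E` (`[E_m:F] = d·p^m`, generator `θ`), then
`(Σ_j x j, Tr_{E_m/E'_m} y)` is a level-`m` Amice pair for the `ℤ_p`-subtower `E'` (generator `Tr θ`). [cite: deShalit1987, Ch. I §3.1, §3.8 (16)] -/
theorem IsAmiceLevel.indexTrace {m : ℕ} {θ : unitBall (E m)} {hθ : IsIntegralNormalGen (E m) θ} {x : ZMod d → PowerSeries 𝒪[F]}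
    {y : unitBall (E m)} (hx : IsAmiceLevel p d hd σ₀ hθ x y) :
    IsAmiceLevel p 1 (Nat.coprime_one_left p) σ₀ (E := E') (hθ.unitBallTrace (h m)) (fun _ => ∑ j : ZMod d, x j) (unitBallTrace (h m) y) := by
  intro j'
  rw [← sum_amiceSum_eq_amiceSum_trace hd E E' h hE hE' hdeg hdeg' hσ₀ m hθ y j', ← Finset.sum_sub_distrib]
  exact Finset.dvd_sum fun j _ => hx j

/-! ### §2. The sub-tower data and `Σ (Col_E β) = Col_{E'}(N β)` -/

variable {θ : ∀ m, unitBall (E m)} (hθ : ∀ m, IsIntegralNormalGen (E m) (θ m))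
  (hcoh : ∀ m, unitBallTrace (hmono (Nat.le_succ m)) (θ (m + 1)) = θ m)

omit hp [NeZero d] [∀ m, Normal F (E m)] [∀ m, Normal F (E' m)] in
include hθ in
/-- The traces `θ'_m = Tr_{E_m/E'_m} θ_m` are normal integral generators of the sub-tower. [cite: deShalit1987, Ch. III §1.3 (p. 90)] -/
theorem isIntegralNormalGen_subtower (m : ℕ) : IsIntegralNormalGen (E' m) (unitBallTrace (h m) (θ m)) :=
  (hθ m).unitBallTrace (h m)

omit hp [NeZero d] [∀ m, Normal F (E m)] [∀ m, Normal F (E' m)] in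
include hcoh in
/-- The traces `θ'_m = Tr_{E_m/E'_m} θ_m` are trace-coherent along the sub-tower (transitivity of traces). [cite: deShalit1987, Ch. I §3.8 (16)] -/
theorem coherent_subtower (m : ℕ) :
    unitBallTrace (hmono' (Nat.le_succ m)) (unitBallTrace (h (m + 1)) (θ (m + 1))) = unitBallTrace (h m) (θ m) := by
  rw [unitBallTrace_unitBallTrace, ← hcoh m, unitBallTrace_unitBallTrace]

omit hp [NeZero d] [∀ m, Normal F (E m)] [∀ m, Normal F (E' m)] in
/-- The norms `β'_m = N_{E_m/E'_m} β_m` of a norm-coherent family are norm-coherent along the sub-tower (transitivity of norms).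
[cite: deShalit1987, Ch. III §1.2 Lemma (ii)] -/
theorem baseNormCoherent_subtower {β : ∀ m, RelNormCoherentUnits hπ (E m)} (hβ : ∀ m, (β (m + 1)).baseNorm hπ (hmono (Nat.le_succ m)) = β m)
    (m : ℕ) : ((β (m + 1)).baseNorm hπ (h (m + 1))).baseNorm hπ (hmono' (Nat.le_succ m)) = (β m).baseNorm hπ (h m) := by
  rw [RelNormCoherentUnits.baseNorm_baseNorm, ← hβ m, RelNormCoherentUnits.baseNorm_baseNorm]

variable [IsAdicComplete (Ideal.span {(p : 𝒪[F])}) 𝒪[F]]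

include hdeg hE' hdeg' in
/-- ★ **The trace of `Col_E β` satisfies the `d = 1` transform congruences of the norm family along `E'`** (`isTransformProd_colemanImage` +
`IsAmiceLevel.indexTrace` + `Tr r_β = r_{Nβ}`, `unitBallTrace_coeff_relUnitCoordTwo`). [cite: deShalit1987, Ch. I §3.8 (16)–(17)] -/
theorem isTransformProd_sum_colemanImage {β : ∀ m, RelNormCoherentUnits hπ (E m)}
    (hβ : ∀ m, (β (m + 1)).baseNorm hπ (hmono (Nat.le_succ m)) = β m) :
    IsTransformProd p 1 (Nat.coprime_one_left p) σ₀ (fun m => isIntegralNormalGen_subtower E E' h hθ m)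
      (fun m => relUnitCoordTwo hπ (E' m) hq (hE' m) hσ₀ u hu ((β m).baseNorm hπ (h m)))
      (fun _ => ∑ j : ZMod d, TActModule.toPS (colemanImage hd hπ E hmono hE hdeg hσ₀ hq u hu γ hθ hcoh hβ j)) := by
  intro m k
  have h1 := (isTransformProd_colemanImage hd hπ E hmono hE hdeg hσ₀ hq u hu γ hθ hcoh hβ m k).indexTrace hd E E' h hE hE' hdeg hdeg' hσ₀
  rw [unitBallTrace_coeff_relUnitCoordTwo hπ hq hσ₀ (h m) (hE m) u hu (β m) k] at h1
  have e : (fun _ : ZMod 1 => PowerSeries.coeff k (∑ j : ZMod d, TActModule.toPS (colemanImage hd hπ E hmono hE hdeg hσ₀ hq u hu γ hθ hcoh hβ j))) =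
      fun _ : ZMod 1 => ∑ j : ZMod d, PowerSeries.coeff k (TActModule.toPS (colemanImage hd hπ E hmono hE hdeg hσ₀ hq u hu γ hθ hcoh hβ j)) :=
    funext fun _ => map_sum _ _ _
  rw [e]
  exact h1

variable [IsAdicComplete (Ideal.span {intBase F (LTCoeff.of F π)}) (PowerSeries 𝒪[F])]

include hdeg hE hdeg' in
/-- ★★★ **`Σ_j Col_E(β)(j) = Col_{E'}(N_{E/E'} β)`** — the `ℤ/d`-trace of the two-variable Coleman image along `E` (`[E_m:F] = d·p^m`) is the
(`d = 1`) Coleman image, along the `ℤ_p`-subtower `E'_m ≤ E_m` with generators `Tr θ_m`, of the norm family `N_{E_m/E'_m} β_m` — de Shalit's square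
(16)/(17): `i` commutes with restriction to the subgroup `ℤ_p ≤ ℤ/d × ℤ_p` / the norm.  Hence the trace chain's `N_Σ = Σ(Col 𝒰¹_∞(E))` and
`Col_Σ(C)` are Coleman images of NORMS in the `ℤ_p`-tower. [cite: deShalit1987, Ch. I §3.5, §3.8 (16)–(17); Ch. III §1.3] -/
theorem indexTraceₗ_colemanImage_eq_colemanImage_subtower {β : ∀ m, RelNormCoherentUnits hπ (E m)}
    (hβ : ∀ m, (β (m + 1)).baseNorm hπ (hmono (Nat.le_succ m)) = β m) (j' : ZMod 1) :
    indexTraceₗ hπ hq u hu γ (colemanImage hd hπ E hmono hE hdeg hσ₀ hq u hu γ hθ hcoh hβ) =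
      colemanImage (Nat.coprime_one_left p) hπ E' hmono' hE' hdeg' hσ₀ hq u hu γ (isIntegralNormalGen_subtower E E' h hθ)
        (coherent_subtower E E' hmono hmono' h hcoh) (β := fun m => (β m).baseNorm hπ (h m))
        (baseNormCoherent_subtower hπ E E' hmono hmono' h hβ) j' := by
  apply TActModule.toPS_injective
  have huniq := toPS_colemanImage_eq_of_isTransformProd (Nat.coprime_one_left p) hπ E' hmono' hE' hdeg' hσ₀ hq u hu γ
    (isIntegralNormalGen_subtower E E' h hθ) (coherent_subtower E E' hmono hmono' h hcoh) (β := fun m => (β m).baseNorm hπ (h m))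
    (baseNormCoherent_subtower hπ E E' hmono hmono' h hβ)
    (isTransformProd_sum_colemanImage hd hπ E E' hmono h hE hE' hdeg hdeg' hσ₀ hq u hu γ hθ hcoh hβ)
  rw [congrFun huniq j', indexTraceₗ_apply, map_sum]

end UnitsImageTraceNormTwo

end Literature.NumberTheory.GaloisRepresentations
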